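import Literature.Analysis.FluidPDE.Seregin2020SwirlMoserEnergyBound
import Literature.Analysis.FluidPDE.Seregin2020SwirlMoserCutoffs
import Literature.Analysis.FluidPDE.Seregin2020SwirlMoserTools
import Literature.Analysis.FluidPDE.SqIntegralBalance
import HarnessLib

/-!
# Seregin 2020, proof of Thm 2.1, removal of the axis cut-off (`ε → 0`): slice tools

Analysis/FluidPDE proofs file (theorems only: no definitions, no named facts) on the Moser-iteration
half of the proof of G. Seregin, *Local regularity of axisymmetric solutions to the Navier–Stokes
equations*, Anal. Math. Phys. 10 (2020) Paper 46 = arXiv:2006.04140, Thm 2.1 — the swirl bound (2.6),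
which is also Lemma 3.3 / (as1) of Seregin–Šverák 2009 (arXiv:0804.1803, §3 p. 9, App. II). PORT (Literature
placement, so that Literature files may import it) of the Summits-side helper
`Summits/NavierStokesRegularity/NavierStokesRegularity/Theorems/AxisymmetricExtremalityAxisymmetricKatoGlobalStubSeregin2020TypeIIMoserA.lean`
(namespace `Summit.NavierStokesRegularity.NavierStokesRegularity.Theorems.AxisymmetricKatoGlobal.EulerScaling`,
2026-08-17): statements and proofs verbatim, namespace `Literature.Analysis.FluidPDE.Seregin2020`; the
original is untouched. The printed proof (arXiv
pp. 5–6) multiplies the swirl equation by `σ_N^{2m-1}ψ⁴φ²` with an axis cut-off `φ = φ_ε`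
("`φ(x') = 0` if `|x'| < ε/2`, `φ(x') = 1` if `|x'| > ε`, `|∇ᵏφ| ≤ cε⁻ᵏ`") and then lets
`ε → 0`: the three shell terms `I₁, I₂, I₃` tend to zero because `|σ|, |σ_N| ≤ ϱ|v|` on the
shell `ε/2 < ϱ < ε` ("So, passing to the limit in the energy inequality, we find …", p. 6). The
tree has the energy inequality and its `L^{10/3}` consequence WITH the axis cut-off
(`Seregin2020.swirl_moser_tenThirds_le`, cut-off `Θ` supported off the axis, right-hand side
`ℛ = ∫(4ηP + ηP_V + ηB_b + |η'|M)`). This file supplies the slice-by-slice splitting of that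
right-hand side for `Θ = Φ·φ_ε` (`Φ` the radial cut-off) into an `ε`-free majorant and a shell
error:

* `aemeasurable_prod_restrict_of_continuousOn_offAxis` — joint a.e.-measurability on
  `]t₁,t₂[ × A` from continuity on `]t₁,t₂[ × (A ∖ axis)` (the axis is null);
* `moser_split_pointwise`, `moser_shell_pointwise`, `ofReal_sq_add_cube_le` — the pointwise
  inequalities `4ηH|∇Θ|² + ηH|V|‖∇Θ²‖ + η(2/ϱ)H(∂_ϱΘ²)⁺ + |η'|HΘ² ≤ main + err`,
  `err ≤ c(L,C_T)(|V|² + |V|³)` on the shell (`H(σ) ≤ Lσ² ≤ Lϱ²|V|²`), `err = 0` off it;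
* `swirl_moser_sliceMajorant_le` — for every time slice,
  `ofReal(4ηP + ηP_V + ηB_b + |η'|M) ≤ ∫⁻ ofReal(main) + c ∫⁻_{ϱ≤ε, |x|≤r₁} (1 + ‖V‖ₑ^{10/3})`.

## References

* G. Seregin, Anal. Math. Phys. 10 (2020), Paper 46 = arXiv:2006.04140, proof of Thm. 2.1,
  p. 6 (the terms `I₁, I₂, I₃` and the limit `ε → 0`). [Seregin2020]
-/

noncomputable section

open MeasureTheory Set Function Filter Topology TopologicalSpace Metric
open scoped NNReal ENNReal InnerProductSpace RealInnerProductSpace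

namespace Literature.Analysis.FluidPDE.Seregin2020

open Literature.Analysis.FluidPDE Literature.Analysis.FluidPDE.SereginZajaczkowski2007
  Literature.Analysis.FluidPDE.SereginSverak2009 Literature.Analysis.FluidPDE.Seregin2020
  Literature.Analysis.FluidPDE.LeiZhang2011

/-! ### Measure-theoretic tools -/

/-- **Joint a.e.-measurability from continuity off the axis.** If `F` is continuous on
`I × (A ∖ {ϱ = 0})` (`I`, `A` measurable), then `F` is a.e.-measurable for
`(vol|_I ⊗ vol)|_{ℝ × A}`: the axis `{ϱ = 0}` is Lebesgue-null in `ℝ³`. [cite: Seregin2020, proof of Thm 2.1 (arXiv pp. 5–6): the energy identity is integrated over 𝒞 × ]-1, t_*[ minus the axis {x' = 0}, a Lebesgue-null set (measure-theoretic form)] -/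
theorem aemeasurable_prod_restrict_of_continuousOn_offAxis {β : Type*} [MeasurableSpace β]
    [TopologicalSpace β] [BorelSpace β] {I : Set ℝ} (hI : MeasurableSet I)
    {A : Set (EuclideanSpace ℝ (Fin 3))} (hA : MeasurableSet A)
    {F : ℝ × EuclideanSpace ℝ (Fin 3) → β}
    (hF : ContinuousOn F (I ×ˢ (A ∩ {x | cylRadius x ≠ 0}))) :
    AEMeasurable F (((volume.restrict I).prod (volume : Measure (EuclideanSpace ℝ (Fin 3)))).restrict
      (univ ×ˢ A)) := by
  set B : Set (ℝ × EuclideanSpace ℝ (Fin 3)) := I ×ˢ (A ∩ {x | cylRadius x ≠ 0}) with hB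
  have hopen : IsOpen {x : EuclideanSpace ℝ (Fin 3) | cylRadius x ≠ 0} :=
    isOpen_ne_fun continuous_cylRadius continuous_const
  have hBm : MeasurableSet B := hI.prod (hA.inter hopen.measurableSet)
  have hμ : ((volume.restrict I).prod (volume : Measure (EuclideanSpace ℝ (Fin 3)))).restrict (univ ×ˢ A) =
      ((volume : Measure ℝ).prod (volume : Measure (EuclideanSpace ℝ (Fin 3)))).restrict B := by
    rw [Measure.restrict_prod_eq_prod_univ, Measure.restrict_restrict (MeasurableSet.univ.prod hA),
      prod_inter_prod, univ_inter, inter_univ]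
    refine Measure.restrict_congr_set ?_
    have hdiff : (I ×ˢ A) \ B ⊆ univ ×ˢ {x : EuclideanSpace ℝ (Fin 3) | cylRadius x = 0} := by
      rintro p ⟨⟨h1, h2⟩, h3⟩
      refine ⟨mem_univ _, ?_⟩
      by_contra h4
      exact h3 ⟨h1, h2, h4⟩
    have hnull : ((volume : Measure ℝ).prod (volume : Measure (EuclideanSpace ℝ (Fin 3)))) ((I ×ˢ A) \ B) = 0 := by
      refine measure_mono_null hdiff ?_
      rw [Measure.prod_prod, volume_setOf_cylRadius_eq_zero, mul_zero]
    have hsub : B ⊆ I ×ˢ A := prod_mono Subset.rfl inter_subset_left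
    exact ae_eq_set.2 ⟨hnull, measure_mono_null (fun p hp => absurd (hsub hp.1) hp.2) measure_empty⟩
  rw [hμ]
  exact hF.aemeasurable hBm

/-! ### Pointwise inequalities of the `ε → 0` step -/

/-- **The pointwise splitting of the right-hand side of the energy inequality for
`Θ = Φ φ_ε`** into the `ε`-free part and the shell part: with `|∇Θ|² ≤ 2|∇Φ|² + 2Φ²|∇φ|²`,
`‖∇Θ²‖ ≤ 2Θ(|∇Φ| + Φ|∇φ|)`, `(∂_ϱΘ²)⁺ ≤ 2Φ²φ∂_ϱφ`, `0 ≤ Θ ≤ Φ`,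
`4ηH gΘ² + ηH v gΘ2 + η(2/ϱ)H d⁺ + |η'|HΘ² ≤ H(8η gΦ² + 2η vΦgΦ + |η'|Φ²) + ηHΦ²(8gφ² + 2v gφ + (4/ϱ)φ dφ)`.
[cite: Seregin2020, proof of Thm 2.1 (arXiv p. 6), the terms I₁, I₂, I₃] -/
theorem moser_split_pointwise {η dη Hs Θ Φ φ gΘ gΦ gφ gΘ2 dpos dφ v ρ : ℝ}
    (hη : 0 ≤ η) (hdη : 0 ≤ dη) (hHs : 0 ≤ Hs) (hΘ : 0 ≤ Θ) (hΘΦ : Θ ≤ Φ)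
    (hgΦ : 0 ≤ gΦ) (hgφ : 0 ≤ gφ) (hv : 0 ≤ v) (hρ : 0 ≤ ρ)
    (h1 : gΘ ^ 2 ≤ 2 * gΦ ^ 2 + 2 * (Φ ^ 2 * gφ ^ 2))
    (h2 : gΘ2 ≤ 2 * Θ * (gΦ + Φ * gφ))
    (h3 : dpos ≤ 2 * (Φ ^ 2 * (φ * dφ))) :
    4 * (η * (Hs * gΘ ^ 2)) + η * (Hs * (v * gΘ2)) + η * (2 / ρ * (Hs * dpos)) + dη * (Hs * Θ ^ 2) ≤
      Hs * (8 * η * gΦ ^ 2 + 2 * η * (v * (Φ * gΦ)) + dη * Φ ^ 2) +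
        η * Hs * Φ ^ 2 * (8 * gφ ^ 2 + 2 * v * gφ + 4 / ρ * (φ * dφ)) := by
  have hΦ : 0 ≤ Φ := hΘ.trans hΘΦ
  have hηH : 0 ≤ η * Hs := mul_nonneg hη hHs
  have t1 : 4 * (η * (Hs * gΘ ^ 2)) ≤ 4 * (η * Hs) * (2 * gΦ ^ 2 + 2 * (Φ ^ 2 * gφ ^ 2)) := by
    have := mul_le_mul_of_nonneg_left h1 hηH
    nlinarith
  have t2 : η * (Hs * (v * gΘ2)) ≤ (η * Hs) * v * (2 * Φ * (gΦ + Φ * gφ)) := by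
    have h2' : gΘ2 ≤ 2 * Φ * (gΦ + Φ * gφ) := by
      refine h2.trans ?_
      have : 0 ≤ gΦ + Φ * gφ := by positivity
      nlinarith
    have := mul_le_mul_of_nonneg_left h2' (mul_nonneg hηH hv)
    nlinarith
  have t3 : η * (2 / ρ * (Hs * dpos)) ≤ (η * Hs) * (2 / ρ) * (2 * (Φ ^ 2 * (φ * dφ))) := by
    have h2ρ : 0 ≤ 2 / ρ := div_nonneg zero_le_two hρ
    have := mul_le_mul_of_nonneg_left h3 (mul_nonneg hηH h2ρ)
    nlinarith
  have t4 : dη * (Hs * Θ ^ 2) ≤ dη * (Hs * Φ ^ 2) := by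
    have : Θ ^ 2 ≤ Φ ^ 2 := pow_le_pow_left₀ hΘ hΘΦ 2
    have := mul_le_mul_of_nonneg_left this (mul_nonneg hdη hHs)
    nlinarith
  have e : 4 * (η * Hs) * (2 * gΦ ^ 2 + 2 * (Φ ^ 2 * gφ ^ 2)) + (η * Hs) * v * (2 * Φ * (gΦ + Φ * gφ)) +
      (η * Hs) * (2 / ρ) * (2 * (Φ ^ 2 * (φ * dφ))) + dη * (Hs * Φ ^ 2) =
      Hs * (8 * η * gΦ ^ 2 + 2 * η * (v * (Φ * gΦ)) + dη * Φ ^ 2) +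
        η * Hs * Φ ^ 2 * (8 * gφ ^ 2 + 2 * v * gφ + 4 / ρ * (φ * dφ)) := by ring
  linarith [t1, t2, t3, t4, e.le]

/-- **The shell term is small pointwise**: with `H(σ) ≤ L(ϱ|V|)²` (`H ≤ Lτ²`, `|σ| ≤ ϱ|V|`),
`η, Φ, φ ≤ 1`, `|∇φ|, ∂_ϱφ ≤ 2C_T/ε` and `0 < ϱ ≤ ε ≤ 1`,
`ηHΦ²(8|∇φ|² + 2|V||∇φ| + (4/ϱ)φ∂_ϱφ) ≤ (32LC_T² + 8LC_T)|V|² + 4LC_T|V|³`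
(the bounds `I₁ ≤ cN^{2m-1}∫|v|²`, `I₂, I₃ ≤ cN^{2m-1}ε⁻¹∫|v_φ|` of the paper, in the tree's
quadratic-growth form of the truncation). [cite: Seregin2020, proof of Thm 2.1 (arXiv p. 6), the terms I₁, I₂, I₃] -/
theorem moser_shell_pointwise {η Hs Φ φ gφ dφ v ρ ε L CT : ℝ}
    (hη0 : 0 ≤ η) (hη1 : η ≤ 1) (hHs0 : 0 ≤ Hs) (hHs : Hs ≤ L * (ρ * v) ^ 2) (hL : 0 ≤ L) (hCT : 0 ≤ CT)
    (hΦ0 : 0 ≤ Φ) (hΦ1 : Φ ≤ 1) (hφ0 : 0 ≤ φ) (hφ1 : φ ≤ 1) (hgφ0 : 0 ≤ gφ) (hgφ : gφ ≤ 2 * CT / ε)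
    (hdφ0 : 0 ≤ dφ) (hdφ : dφ ≤ 2 * CT / ε) (hv : 0 ≤ v) (hρ0 : 0 < ρ) (hρε : ρ ≤ ε) (hε1 : ε ≤ 1) :
    η * Hs * Φ ^ 2 * (8 * gφ ^ 2 + 2 * v * gφ + 4 / ρ * (φ * dφ)) ≤
      (32 * L * CT ^ 2 + 8 * L * CT) * v ^ 2 + 4 * L * CT * v ^ 3 := by
  have hε : 0 < ε := lt_of_lt_of_le hρ0 hρε
  have hq0 : 0 < ρ / ε := div_pos hρ0 hε
  have hq1 : ρ / ε ≤ 1 := (div_le_one hε).2 hρε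
  -- the bracket
  have hB0 : 0 ≤ 8 * gφ ^ 2 + 2 * v * gφ + 4 / ρ * (φ * dφ) := by positivity
  have hB : 8 * gφ ^ 2 + 2 * v * gφ + 4 / ρ * (φ * dφ) ≤
      32 * CT ^ 2 / ε ^ 2 + 4 * CT * v / ε + 8 * CT / (ρ * ε) := by
    have c1 : 8 * gφ ^ 2 ≤ 32 * CT ^ 2 / ε ^ 2 := by
      have := pow_le_pow_left₀ hgφ0 hgφ 2
      calc 8 * gφ ^ 2 ≤ 8 * (2 * CT / ε) ^ 2 := by linarith
        _ = 32 * CT ^ 2 / ε ^ 2 := by field_simp; ring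
    have c2 : 2 * v * gφ ≤ 4 * CT * v / ε := by
      have := mul_le_mul_of_nonneg_left hgφ hv
      calc 2 * v * gφ = 2 * (v * gφ) := by ring
        _ ≤ 2 * (v * (2 * CT / ε)) := by linarith
        _ = 4 * CT * v / ε := by ring
    have c3 : 4 / ρ * (φ * dφ) ≤ 8 * CT / (ρ * ε) := by
      calc 4 / ρ * (φ * dφ) ≤ 4 / ρ * (1 * (2 * CT / ε)) :=
            mul_le_mul_of_nonneg_left (mul_le_mul hφ1 hdφ hdφ0 zero_le_one) (by positivity)
        _ = 8 * CT / (ρ * ε) := by field_simp; ring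
    linarith
  -- the prefactor
  have hpre : η * Hs * Φ ^ 2 ≤ L * (ρ * v) ^ 2 := by
    have hΦ2 : Φ ^ 2 ≤ 1 := pow_le_one₀ hΦ0 hΦ1
    calc η * Hs * Φ ^ 2 ≤ 1 * Hs * 1 := by
          have := mul_le_mul hη1 (mul_le_mul le_rfl hΦ2 (sq_nonneg _) hHs0) (by positivity) zero_le_one
          nlinarith [this]
      _ = Hs := by ring
      _ ≤ L * (ρ * v) ^ 2 := hHs
  have hpre0 : 0 ≤ η * Hs * Φ ^ 2 := by positivity
  calc η * Hs * Φ ^ 2 * (8 * gφ ^ 2 + 2 * v * gφ + 4 / ρ * (φ * dφ))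
      ≤ L * (ρ * v) ^ 2 * (32 * CT ^ 2 / ε ^ 2 + 4 * CT * v / ε + 8 * CT / (ρ * ε)) :=
        mul_le_mul hpre hB hB0 (by positivity)
    _ = 32 * L * CT ^ 2 * v ^ 2 * (ρ / ε) ^ 2 + 4 * L * CT * v ^ 3 * (ε * (ρ / ε) ^ 2) +
          8 * L * CT * v ^ 2 * (ρ / ε) := by
        field_simp
    _ ≤ 32 * L * CT ^ 2 * v ^ 2 * 1 + 4 * L * CT * v ^ 3 * 1 + 8 * L * CT * v ^ 2 * 1 := by
        have hq2 : (ρ / ε) ^ 2 ≤ 1 := pow_le_one₀ hq0.le hq1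
        have hq3 : ε * (ρ / ε) ^ 2 ≤ 1 := by
          calc ε * (ρ / ε) ^ 2 ≤ 1 * 1 := mul_le_mul hε1 hq2 (sq_nonneg _) zero_le_one
            _ = 1 := one_mul _
        gcongr
    _ = (32 * L * CT ^ 2 + 8 * L * CT) * v ^ 2 + 4 * L * CT * v ^ 3 := by ring

/-- `ofReal(K₂|w|² + K₃|w|³) ≤ ofReal(K₂ + K₃)(1 + ‖w‖ₑ^{10/3})` (`y², y³ ≤ 1 + y^{10/3}` for
`y ≥ 0`). [folklore] -/
private theorem ofReal_sq_add_cube_le {K₂ K₃ : ℝ} (hK₂ : 0 ≤ K₂) (hK₃ : 0 ≤ K₃) (w : EuclideanSpace ℝ (Fin 3)) :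
    ENNReal.ofReal (K₂ * ‖w‖ ^ 2 + K₃ * ‖w‖ ^ 3) ≤
      ENNReal.ofReal (K₂ + K₃) * (1 + ‖w‖ₑ ^ (10 / 3 : ℝ)) := by
  have hy : 0 ≤ ‖w‖ := norm_nonneg w
  have hpow : ∀ n : ℕ, (n : ℝ) ≤ 10 / 3 → ‖w‖ ^ n ≤ 1 + ‖w‖ ^ (10 / 3 : ℝ) := by
    intro n hn
    rcases le_or_gt ‖w‖ 1 with h | h
    · have : ‖w‖ ^ n ≤ 1 := pow_le_one₀ hy h
      have : 0 ≤ ‖w‖ ^ (10 / 3 : ℝ) := Real.rpow_nonneg hy _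
      linarith
    · have : ‖w‖ ^ n ≤ ‖w‖ ^ (10 / 3 : ℝ) := by
        rw [← Real.rpow_natCast]
        exact Real.rpow_le_rpow_of_exponent_le h.le hn
      linarith
  have h2 := hpow 2 (by norm_num)
  have h3 := hpow 3 (by norm_num)
  have hreal : K₂ * ‖w‖ ^ 2 + K₃ * ‖w‖ ^ 3 ≤ (K₂ + K₃) * (1 + ‖w‖ ^ (10 / 3 : ℝ)) := by
    have a := mul_le_mul_of_nonneg_left h2 hK₂
    have b := mul_le_mul_of_nonneg_left h3 hK₃
    linarith
  calc ENNReal.ofReal (K₂ * ‖w‖ ^ 2 + K₃ * ‖w‖ ^ 3)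
      ≤ ENNReal.ofReal ((K₂ + K₃) * (1 + ‖w‖ ^ (10 / 3 : ℝ))) := ENNReal.ofReal_le_ofReal hreal
    _ = ENNReal.ofReal (K₂ + K₃) * (1 + ‖w‖ₑ ^ (10 / 3 : ℝ)) := by
        rw [ENNReal.ofReal_mul (add_nonneg hK₂ hK₃), ENNReal.ofReal_add zero_le_one (Real.rpow_nonneg hy _),
          ENNReal.ofReal_one, ← ENNReal.ofReal_rpow_of_nonneg hy (by norm_num), ofReal_norm]

/-- `ofReal (c ∫ f) ≤ ∫⁻ ofReal (c f)` for `c ≥ 0` and a pointwise nonnegative `f` (no integrability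
needed: a non-integrable `f` has Bochner integral `0`). [folklore] -/
private theorem ofReal_const_mul_integral_le {α : Type*} [MeasurableSpace α] {μ : Measure α} {c : ℝ} (hc : 0 ≤ c)
    {f : α → ℝ} (hf : ∀ x, 0 ≤ f x) :
    ENNReal.ofReal (c * ∫ x, f x ∂μ) ≤ ∫⁻ x, ENNReal.ofReal (c * f x) ∂μ := by
  have h0 : ENNReal.ofReal (∫ x, f x ∂μ) ≤ ∫⁻ x, ENNReal.ofReal (f x) ∂μ := by
    by_cases hfi : Integrable f μ
    · rw [ofReal_integral_eq_lintegral_ofReal hfi (ae_of_all _ hf)]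
    · rw [integral_undef hfi, ENNReal.ofReal_zero]
      exact zero_le
  rw [ENNReal.ofReal_mul hc]
  calc ENNReal.ofReal c * ENNReal.ofReal (∫ x, f x ∂μ)
      ≤ ENNReal.ofReal c * ∫⁻ x, ENNReal.ofReal (f x) ∂μ := mul_le_mul_right h0 _
    _ = ∫⁻ x, ENNReal.ofReal c * ENNReal.ofReal (f x) ∂μ := (lintegral_const_mul' _ _ ENNReal.ofReal_ne_top).symm
    _ = ∫⁻ x, ENNReal.ofReal (c * f x) ∂μ := lintegral_congr fun x => (ENNReal.ofReal_mul hc).symm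

/-! ### The slice-by-slice splitting of the right-hand side -/

/-- **The right-hand side of the energy inequality for `Θ = Φ φ_ε`, slice by slice**
(Seregin 2020, proof of Thm 2.1, arXiv p. 6: the error terms `I₁, I₂, I₃` of the removal of the
axis cut-off). For the radial cut-off `Φ = radialCutoff r r₁`, the axis cut-off
`φ_ε = smoothTransition((2/ε)ϱ - 1)` (`0 < ε ≤ 1`), `Θ = Φ φ_ε`, a profile `H ≥ 0` of quadratic
growth `H(τ) ≤ Lτ²`, a time weight `0 ≤ η ≤ 1`, and ANY velocity field `V` (`σ = swirl V`), at each
time `s`: `ofReal(4ηP + ηP_V + ηB_b + |η'|M) ≤ ∫⁻ ofReal(H(σ)(8η|∇Φ|² + 2η|V|Φ|∇Φ| + |η'|Φ²)) + (32LC_T² + 12LC_T) ∫⁻_{ϱ ≤ ε, |x| ≤ r₁} (1 + ‖V‖ₑ^{10/3})`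
(`P = ∫H(σ)|∇Θ|²`, `P_V = ∫H(σ)|V|‖∇Θ²‖`, `B_b = ∫(2/ϱ)H(σ)(∂_ϱΘ²)⁺`, `M = ∫H(σ)Θ²`), provided the
`ε`-free integrand is a.e.-measurable on that slice.
[cite: Seregin2020, proof of Thm 2.1 (arXiv p. 6), the terms I₁, I₂, I₃] -/
theorem swirl_moser_sliceMajorant_le :
    ∀ (V : ℝ → EuclideanSpace ℝ (Fin 3) → EuclideanSpace ℝ (Fin 3)) (r r₁ : ℝ), 0 ≤ r → r < r₁ →
    ∀ (H : ℝ → ℝ), (∀ v, 0 ≤ H v) → ∀ (L : ℝ), 0 ≤ L → (∀ v, H v ≤ L * v ^ 2) →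
    ∀ (η : ℝ → ℝ), (∀ s, 0 ≤ η s) → (∀ s, η s ≤ 1) →
    ∀ (ε : ℝ), 0 < ε → ε ≤ 1 → ∀ (CT : ℝ), (∀ t, |deriv Real.smoothTransition t| ≤ CT) →
    ∀ (φ Θ : EuclideanSpace ℝ (Fin 3) → ℝ), (∀ x, φ x = Real.smoothTransition (2 / ε * cylRadius x - 1)) →
    (∀ x, Θ x = radialCutoff r r₁ x * φ x) → ∀ (s : ℝ),
    AEMeasurable (fun x => ENNReal.ofReal (H (swirl (V s) x) *
      (8 * η s * ‖gradient (radialCutoff r r₁ : EuclideanSpace ℝ (Fin 3) → ℝ) x‖ ^ 2 +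
        2 * η s * (‖V s x‖ * (radialCutoff r r₁ x * ‖gradient (radialCutoff r r₁ : EuclideanSpace ℝ (Fin 3) → ℝ) x‖)) +
        |deriv η s| * radialCutoff r r₁ x ^ 2))) volume →
    ENNReal.ofReal (4 * (η s * ∫ x, H (swirl (V s) x) * ‖gradient Θ x‖ ^ 2) +
        η s * (∫ x, H (swirl (V s) x) * (‖V s x‖ * ‖gradient (fun y => Θ y ^ 2) x‖)) +
        η s * (∫ x, 2 / cylRadius x * (H (swirl (V s) x) * max (fderiv ℝ (fun y => Θ y ^ 2) x (eR x)) 0)) +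
        |deriv η s| * ∫ x, H (swirl (V s) x) * Θ x ^ 2) ≤
      (∫⁻ x, ENNReal.ofReal (H (swirl (V s) x) *
        (8 * η s * ‖gradient (radialCutoff r r₁ : EuclideanSpace ℝ (Fin 3) → ℝ) x‖ ^ 2 +
          2 * η s * (‖V s x‖ * (radialCutoff r r₁ x * ‖gradient (radialCutoff r r₁ : EuclideanSpace ℝ (Fin 3) → ℝ) x‖)) +
          |deriv η s| * radialCutoff r r₁ x ^ 2))) +
      ENNReal.ofReal (32 * L * CT ^ 2 + 12 * L * CT) *
        ∫⁻ x in {x | cylRadius x ≤ ε} ∩ closedBall (0 : EuclideanSpace ℝ (Fin 3)) r₁, (1 + ‖V s x‖ₑ ^ (10 / 3 : ℝ)) := by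
  intro V r r₁ hr hrr₁ H hH0 L hL hHL η hη0 hη1 ε hε hε1 CT hCT φ Θ hφ hΘ s hmain
  obtain ⟨hφC, hφ01, hφ0, -, hφr0, hφrle, hφg, hφoff⟩ := axisCutoff_props hε hCT hφ
  obtain ⟨-, -, -, hΘ01, hΘΦ, hgΘ, hgΘ2, hpos⟩ := productCutoff_props hr hrr₁ hφC hφ01 hφ0 hφr0 hΘ
  set Φ : EuclideanSpace ℝ (Fin 3) → ℝ := radialCutoff r r₁ with hΦdef
  have hCT0 : 0 ≤ CT := (abs_nonneg _).trans (hCT 0)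
  set σ : EuclideanSpace ℝ (Fin 3) → ℝ := swirl (V s) with hσ
  set A : Set (EuclideanSpace ℝ (Fin 3)) := {x | cylRadius x ≤ ε} ∩ closedBall (0 : EuclideanSpace ℝ (Fin 3)) r₁ with hA
  have hAm : MeasurableSet A :=
    (isClosed_le continuous_cylRadius continuous_const).measurableSet.inter isClosed_closedBall.measurableSet
  set K : ℝ≥0∞ := ENNReal.ofReal (32 * L * CT ^ 2 + 12 * L * CT) with hK
  -- the four integrands and the two majorants
  set f1 : EuclideanSpace ℝ (Fin 3) → ℝ := fun x => H (σ x) * ‖gradient Θ x‖ ^ 2 with hf1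
  set f2 : EuclideanSpace ℝ (Fin 3) → ℝ := fun x => H (σ x) * (‖V s x‖ * ‖gradient (fun y => Θ y ^ 2) x‖) with hf2
  set f3 : EuclideanSpace ℝ (Fin 3) → ℝ := fun x =>
    2 / cylRadius x * (H (σ x) * max (fderiv ℝ (fun y => Θ y ^ 2) x (eR x)) 0) with hf3
  set f4 : EuclideanSpace ℝ (Fin 3) → ℝ := fun x => H (σ x) * Θ x ^ 2 with hf4
  set main : EuclideanSpace ℝ (Fin 3) → ℝ := fun x => H (σ x) *
    (8 * η s * ‖gradient Φ x‖ ^ 2 + 2 * η s * (‖V s x‖ * (Φ x * ‖gradient Φ x‖)) + |deriv η s| * Φ x ^ 2) with hmain_def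
  set G : EuclideanSpace ℝ (Fin 3) → ℝ≥0∞ := fun x => K * (1 + ‖V s x‖ₑ ^ (10 / 3 : ℝ)) with hG
  have hf1n : ∀ x, 0 ≤ f1 x := fun x => mul_nonneg (hH0 _) (sq_nonneg _)
  have hf2n : ∀ x, 0 ≤ f2 x := fun x => mul_nonneg (hH0 _) (mul_nonneg (norm_nonneg _) (norm_nonneg _))
  have hf3n : ∀ x, 0 ≤ f3 x := fun x =>
    mul_nonneg (div_nonneg zero_le_two (cylRadius_nonneg x)) (mul_nonneg (hH0 _) (le_max_right _ _))
  have hf4n : ∀ x, 0 ≤ f4 x := fun x => mul_nonneg (hH0 _) (sq_nonneg _)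
  have hηs := hη0 s
  have hdη : 0 ≤ |deriv η s| := abs_nonneg _
  -- (1) `ofReal` of the combination is at most the lintegral of the combined integrand
  have step1 : ENNReal.ofReal (4 * (η s * ∫ x, f1 x) + η s * (∫ x, f2 x) + η s * (∫ x, f3 x) +
      |deriv η s| * ∫ x, f4 x) ≤
      ∫⁻ x, ENNReal.ofReal (4 * (η s * f1 x) + η s * f2 x + η s * f3 x + |deriv η s| * f4 x) := by
    have e4 : 4 * (η s * ∫ x, f1 x) = (4 * η s) * ∫ x, f1 x := by ring
    calc ENNReal.ofReal (4 * (η s * ∫ x, f1 x) + η s * (∫ x, f2 x) + η s * (∫ x, f3 x) + |deriv η s| * ∫ x, f4 x)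
        ≤ ENNReal.ofReal (4 * (η s * ∫ x, f1 x)) + ENNReal.ofReal (η s * ∫ x, f2 x) +
            ENNReal.ofReal (η s * ∫ x, f3 x) + ENNReal.ofReal (|deriv η s| * ∫ x, f4 x) :=
          ENNReal.ofReal_add_le.trans (add_le_add (ENNReal.ofReal_add_le.trans
            (add_le_add ENNReal.ofReal_add_le le_rfl)) le_rfl)
      _ ≤ (∫⁻ x, ENNReal.ofReal (4 * η s * f1 x)) + (∫⁻ x, ENNReal.ofReal (η s * f2 x)) +
            (∫⁻ x, ENNReal.ofReal (η s * f3 x)) + ∫⁻ x, ENNReal.ofReal (|deriv η s| * f4 x) := by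
          rw [e4]
          exact add_le_add (add_le_add (add_le_add (ofReal_const_mul_integral_le (by positivity) hf1n)
            (ofReal_const_mul_integral_le hηs hf2n)) (ofReal_const_mul_integral_le hηs hf3n))
            (ofReal_const_mul_integral_le hdη hf4n)
      _ ≤ (∫⁻ x, (ENNReal.ofReal (4 * η s * f1 x) + ENNReal.ofReal (η s * f2 x))) +
            (∫⁻ x, ENNReal.ofReal (η s * f3 x)) + ∫⁻ x, ENNReal.ofReal (|deriv η s| * f4 x) :=
          add_le_add (add_le_add (le_lintegral_add _ _) le_rfl) le_rfl
      _ ≤ (∫⁻ x, (ENNReal.ofReal (4 * η s * f1 x) + ENNReal.ofReal (η s * f2 x) + ENNReal.ofReal (η s * f3 x))) +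
            ∫⁻ x, ENNReal.ofReal (|deriv η s| * f4 x) :=
          add_le_add (le_lintegral_add _ _) le_rfl
      _ ≤ ∫⁻ x, (ENNReal.ofReal (4 * η s * f1 x) + ENNReal.ofReal (η s * f2 x) +
            ENNReal.ofReal (η s * f3 x) + ENNReal.ofReal (|deriv η s| * f4 x)) := le_lintegral_add _ _
      _ = ∫⁻ x, ENNReal.ofReal (4 * (η s * f1 x) + η s * f2 x + η s * f3 x + |deriv η s| * f4 x) := by
          refine lintegral_congr fun x => ?_
          have a0 : 0 ≤ 4 * η s * f1 x := by have := hf1n x; positivity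
          have b0 : 0 ≤ η s * f2 x := mul_nonneg hηs (hf2n x)
          have c0 : 0 ≤ η s * f3 x := mul_nonneg hηs (hf3n x)
          have d0 : 0 ≤ |deriv η s| * f4 x := mul_nonneg hdη (hf4n x)
          rw [← ENNReal.ofReal_add a0 b0, ← ENNReal.ofReal_add (add_nonneg a0 b0) c0,
            ← ENNReal.ofReal_add (add_nonneg (add_nonneg a0 b0) c0) d0]
          congr 1
          ring
  -- (2) the pointwise splitting
  have step2 : ∀ x, ENNReal.ofReal (4 * (η s * f1 x) + η s * f2 x + η s * f3 x + |deriv η s| * f4 x) ≤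
      ENNReal.ofReal (main x) + A.indicator G x := by
    intro x
    have hsplit := moser_split_pointwise (η := η s) (dη := |deriv η s|) (Hs := H (σ x)) (Θ := Θ x) (Φ := Φ x)
      (φ := φ x) (gΘ := ‖gradient Θ x‖) (gΦ := ‖gradient Φ x‖) (gφ := ‖gradient φ x‖)
      (gΘ2 := ‖gradient (fun y => Θ y ^ 2) x‖) (dpos := max (fderiv ℝ (fun y => Θ y ^ 2) x (eR x)) 0)
      (dφ := fderiv ℝ φ x (eR x)) (v := ‖V s x‖) (ρ := cylRadius x)
      hηs hdη (hH0 _) (hΘ01 x).1 (hΘΦ x) (norm_nonneg _) (norm_nonneg _) (norm_nonneg _) (cylRadius_nonneg x)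
      (hgΘ x) (hgΘ2 x) (hpos x)
    have herr0 : 0 ≤ η s * H (σ x) * Φ x ^ 2 * (8 * ‖gradient φ x‖ ^ 2 + 2 * ‖V s x‖ * ‖gradient φ x‖ +
        4 / cylRadius x * (φ x * fderiv ℝ φ x (eR x))) := by
      have := hH0 (σ x); have := (hφ01 x).1; have := hφr0 x; have := cylRadius_nonneg x
      positivity
    refine (ENNReal.ofReal_le_ofReal hsplit).trans (ENNReal.ofReal_add_le.trans (add_le_add le_rfl ?_))
    -- the shell term
    by_cases hsh : ε / 2 ≤ cylRadius x ∧ cylRadius x ≤ ε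
    · by_cases hxr : ‖x‖ ≤ r₁
      · have hxA : x ∈ A := ⟨hsh.2, mem_closedBall_zero_iff.2 hxr⟩
        rw [indicator_of_mem hxA, hG]
        have hρ0 : 0 < cylRadius x := lt_of_lt_of_le (by positivity) hsh.1
        have hHs : H (σ x) ≤ L * (cylRadius x * ‖V s x‖) ^ 2 := by
          refine (hHL _).trans (mul_le_mul_of_nonneg_left ?_ hL)
          have hab : |σ x| ≤ cylRadius x * ‖V s x‖ := abs_swirl_le_cylRadius_mul_norm' x (V s x)
          calc σ x ^ 2 = |σ x| ^ 2 := (sq_abs _).symm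
            _ ≤ (cylRadius x * ‖V s x‖) ^ 2 := pow_le_pow_left₀ (abs_nonneg _) hab 2
        have h := moser_shell_pointwise hηs (hη1 s) (hH0 _) hHs hL hCT0 (radialCutoff_nonneg r r₁ x)
          (radialCutoff_le_one r r₁ x) (hφ01 x).1 (hφ01 x).2 (norm_nonneg _) (hφg x) (hφr0 x) (hφrle x)
          (norm_nonneg _) hρ0 hsh.2 hε1
        refine (ENNReal.ofReal_le_ofReal h).trans ?_
        have h2 := ofReal_sq_add_cube_le (K₂ := 32 * L * CT ^ 2 + 8 * L * CT) (K₃ := 4 * L * CT)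
          (by positivity) (by positivity) (V s x)
        have eK : 32 * L * CT ^ 2 + 8 * L * CT + 4 * L * CT = 32 * L * CT ^ 2 + 12 * L * CT := by ring
        rw [eK] at h2
        exact h2
      · have hΦ0 : Φ x = 0 := radialCutoff_eq_zero hr hrr₁ (not_le.1 hxr).le
        rw [hΦ0]
        simp
    · have hd0 : fderiv ℝ φ x = 0 := by
        refine hφoff x ?_
        rcases not_and_or.1 hsh with h | h
        · exact Or.inl (not_le.1 h)
        · exact Or.inr (not_le.1 h)
      have hg0 : gradient φ x = 0 := by simp [gradient, hd0]
      rw [hg0, hd0]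
      simp
  -- (3) integrate
  calc ENNReal.ofReal (4 * (η s * ∫ x, f1 x) + η s * (∫ x, f2 x) + η s * (∫ x, f3 x) + |deriv η s| * ∫ x, f4 x)
      ≤ ∫⁻ x, ENNReal.ofReal (4 * (η s * f1 x) + η s * f2 x + η s * f3 x + |deriv η s| * f4 x) := step1
    _ ≤ ∫⁻ x, (ENNReal.ofReal (main x) + A.indicator G x) := lintegral_mono step2
    _ = (∫⁻ x, ENNReal.ofReal (main x)) + ∫⁻ x, A.indicator G x := lintegral_add_left' hmain _
    _ = (∫⁻ x, ENNReal.ofReal (main x)) + K * ∫⁻ x in A, (1 + ‖V s x‖ₑ ^ (10 / 3 : ℝ)) := by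
        rw [lintegral_indicator hAm, hG, lintegral_const_mul' _ _ ENNReal.ofReal_ne_top]

end Literature.Analysis.FluidPDE.Seregin2020

end
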